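import Summits.QuantumFields.YangMills.Theorems.LangevinControlUVFemtoCurvatureSkewnessDefs
import Summits.QuantumFields.YangMills.Theorems.FemtoCurvatureSkewness.Negative.WildPackage

/-!
# Line `coupling-cubic-response` — crux `LangevinControlUV.FemtoCurvatureSkewness` (item stmt-QuantumFields-9365)

Skeleton v4 (LEAD prover-line-stmt-QuantumFields-9365-c2-0, 2026-08-16; v3 = lead c1, v1 = crux-plan by
planner-cruxplan-stmt-QuantumFields-9365-coupling-cubic-respo-0).  The line's vocabulary, the two CLOSED stubs
(I `PressureCGF` p97990, T `TreeRatioFloor` p104535/p106093), the UV glue `signedRigidity_of_dominance` and the compositions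
`FemtoCurvatureSkewness_of : MarkedCouplingDominance → GlobalSkewSign → InfraredFloor → FemtoCurvatureSkewness`,
`skewnessForPackageMap_of : MarkedCouplingDominance → SkewnessForPackageMap` are ALL LANDED
(`Theorems/LangevinControlUVFemtoCurvatureSkewnessDefs.lean` p107862, `…Reduction.lean` p111143), so this skeleton imports the
Defs file, carries only the three OPEN stubs (same names, same statements as registered by v3), and repeats VERBATIM the two
landed composition proofs of `…Reduction.lean` in a `Skeleton` sub-namespace (the farm had not yet built the Reduction olean when
this version was registered; once it serves it, replace §2 by `import …Reduction`):

* `Stub.MarkedCouplingDominance` (E, the UV ENGINE — crux-sized: Bałaban-grade UV stability of Wilson's measure with three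
  marked plaquette couplings run to one-loop RELATIVE accuracy on femto boxes, plus the honest two-point package = sibling crux
  9363 in honest form; lead c1: `promote-stub`);
* `Stub.GlobalSkewSign` (S, infrared residual I: `κ₃(L,β,n) > 0` for all `β ≥ β_u`, ALL `L ≥ 8n` — the open infrared sign of
  the right-angle `⟨trF² trF² trF²⟩_c`; NECESSARY for the typed `∀ a` crux modulo the covariance uniformities,
  `not_globalSkewSign_of_uniformZeros` / `FemtoCurvatureSkewness_false_of_UniformZeros`);
* `Stub.InfraredFloor` (R, infrared residual II: volume/cutoff-uniform floor of `n¹²|κ₃|` on `{n⁸Cov ≥ ε}`; NECESSARY for the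
  typed crux modulo the uniformities, NOT needed for the ∃-bundled R1 form `SkewnessForPackageMap`).

`sorry` occurs only in the three `Stub.*`; `FemtoCurvatureSkewness_proof` concludes the crux BY NAME.
Disproof.lean (cdisprove v6) honoured as in v3 (findings 1, 2, 3, 4, 4b; §5: the refuted residual `PackagePinsScale` is not used).
-/

noncomputable section

namespace Summit.QuantumFields.YangMills.Cruxes.FemtoCurvatureSkewness.CouplingCubicResponse

open MeasureTheory Filter Topology
open Literature.MathematicalPhysics.QuantumFieldTheory
open Summit.QuantumFields.YangMills.Theses.LangevinControlUV (FemtoCurvatureSkewness)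
open Summit.QuantumFields.YangMills.Theorems.FemtoCurvatureSkewness.Negative (kappa3)

/-! ## Registered stubs `Stub.<Name>` (`sorry` lives only here) -/

namespace Stub

/-- Stub E (ENGINE), registered by name (statement = tree def `MarkedCouplingDominance`, …Defs.lean). -/
theorem MarkedCouplingDominance :
    Summit.QuantumFields.YangMills.Cruxes.FemtoCurvatureSkewness.CouplingCubicResponse.MarkedCouplingDominance := by
  sorry

/-- Stub S (global sign), registered with its statement written out over tree declarations (= tree def `GlobalSkewSign`). -/
theorem GlobalSkewSign :
    ∀ (G : Type) [Group G] [TopologicalSpace G] [IsTopologicalGroup G] [CompactSpace G]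
      [MeasurableSpace G] [BorelSpace G], IsCompactSimpleLieGroup G →
      ∀ (r : LatticeRep G), ∃ βu : ℝ, ∀ (L : ℕ) [NeZero L] (β : ℝ) (n : ℕ),
        βu ≤ β → 1 ≤ n → 8 * n ≤ L → 0 < kappa3 r L β n := by
  sorry

/-- Stub R (infrared floor), registered by name (statement = tree def `InfraredFloor`, …Defs.lean). -/
theorem InfraredFloor :
    Summit.QuantumFields.YangMills.Cruxes.FemtoCurvatureSkewness.CouplingCubicResponse.InfraredFloor := by
  sorry

end Stub

/-! ## The composition (VERBATIM the landed `…Reduction.lean` p111143, in namespace `Skeleton`; no `sorry` below this line) -/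

namespace Skeleton

open Summit.QuantumFields.YangMills.Theorems.FemtoCurvatureSkewness.Negative
  (plaq wE wCov TwoPointPackage SkewnessPackage level_mem_window femtoCurvatureSkewness_iff)

section Glue

variable {G : Type} [Group G] [TopologicalSpace G] [IsTopologicalGroup G] [CompactSpace G]
  [MeasurableSpace G] [BorelSpace G]

/-- **Floor ⇒ the crux's conclusion, for EVERY unit map** (pure logic; verbatim `…Reduction.lean`). -/
theorem skewnessPackage_of_floor (r : LatticeRep G) {a : ℝ → ℝ} (ha : TwoPointPackage r a)
    (hF : SkewnessFloor r) : SkewnessPackage r a := by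
  obtain ⟨Γ, β₀, ℓ₀, c, C, hℓ₀, hc, hapos, -, hΓ, hbox⟩ := ha
  obtain ⟨βu, hFl⟩ := hF
  choose! δ hδpos hδ using hFl
  refine ⟨fun s => δ (c * Γ s), max β₀ βu, ℓ₀, 1, hℓ₀, one_pos, ?_, ?_⟩
  · intro s hs hsl
    exact hδpos _ (mul_pos hc (hΓ s hs hsl).1)
  · intro L _ β hβ hL n hn h8
    have hβ₀ : β₀ ≤ β := le_trans (le_max_left _ _) hβ
    have hβu : βu ≤ β := le_trans (le_max_right _ _) hβ
    obtain ⟨hs, hsl⟩ := level_mem_window hapos hL hn h8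
    have hε : 0 < c * Γ ((n : ℝ) * a β) := mul_pos hc (hΓ _ hs hsl).1
    have hlow : c * Γ ((n : ℝ) * a β) ≤ (n : ℝ) ^ 8 * covAxis r L β n := ((hbox L β hβ₀ hL).1 n hn h8).1
    show 1 * δ (c * Γ ((n : ℝ) * a β)) ≤ (n : ℝ) ^ 12 * |kappa3 r L β n|
    rw [one_mul]
    exact hδ _ hε L β n hβu hn h8 hlow

/-- **Signed rigidity on the femto boxes of a PACKAGE map ⇒ its skewness package** (verbatim `…Reduction.lean`). -/
theorem skewnessPackage_of_signedRigidity (r : LatticeRep G) {a : ℝ → ℝ} (ha : TwoPointPackage r a)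
    (hR : SignedRigidity r a) : SkewnessPackage r a := by
  obtain ⟨β₁, ℓ₁, c₃, hℓ₁, hc₃, hRb⟩ := hR
  obtain ⟨Γ, β₀, ℓ₀, c, C, hℓ₀, hc, hapos, -, hΓ, hbox⟩ := ha
  refine ⟨fun s => (c * Γ s) * Real.sqrt (c * Γ s), max β₁ β₀, min ℓ₁ ℓ₀, c₃, lt_min hℓ₁ hℓ₀, hc₃, ?_, ?_⟩
  · intro s hs hsl
    have : 0 < c * Γ s := mul_pos hc (hΓ s hs (hsl.trans (min_le_right _ _))).1
    show 0 < c * Γ s * Real.sqrt (c * Γ s)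
    exact mul_pos this (Real.sqrt_pos.2 this)
  · intro L _ β hβ hL n hn h8
    have hβ₁ : β₁ ≤ β := le_trans (le_max_left _ _) hβ
    have hβ₀ : β₀ ≤ β := le_trans (le_max_right _ _) hβ
    have hL₁ : (L : ℝ) * a β ≤ ℓ₁ := hL.trans (min_le_left _ _)
    have hL₀ : (L : ℝ) * a β ≤ ℓ₀ := hL.trans (min_le_right _ _)
    obtain ⟨hCpos, hrig⟩ := hRb L β hβ₁ hL₁ n hn h8
    have hlow : c * Γ ((n : ℝ) * a β) ≤ (n : ℝ) ^ 8 * covAxis r L β n := ((hbox L β hβ₀ hL₀).1 n hn h8).1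
    obtain ⟨hs, hsl⟩ := level_mem_window hapos hL₀ hn h8
    have hpos : 0 ≤ c * Γ ((n : ℝ) * a β) := (mul_pos hc (hΓ _ hs hsl).1).le
    set A := (n : ℝ) ^ 8 * covAxis r L β n with hA
    have hmono : c * Γ ((n : ℝ) * a β) * Real.sqrt (c * Γ ((n : ℝ) * a β)) ≤ A * Real.sqrt A :=
      mul_le_mul hlow (Real.sqrt_le_sqrt hlow) (Real.sqrt_nonneg _) (hpos.trans hlow)
    have hn4 : (0 : ℝ) ≤ (n : ℝ) ^ 4 := by positivity
    have hAsqrt : Real.sqrt A = (n : ℝ) ^ 4 * Real.sqrt (covAxis r L β n) := by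
      rw [hA, show ((n : ℝ) ^ 8) = ((n : ℝ) ^ 4) ^ 2 by ring, Real.sqrt_mul (sq_nonneg _), Real.sqrt_sq hn4]
    have hkey : A * Real.sqrt A = (n : ℝ) ^ 12 * (covAxis r L β n * Real.sqrt (covAxis r L β n)) := by
      rw [hAsqrt, hA]; ring
    show c₃ * (c * Γ ((n : ℝ) * a β) * Real.sqrt (c * Γ ((n : ℝ) * a β))) ≤ (n : ℝ) ^ 12 * |kappa3 r L β n|
    calc c₃ * (c * Γ ((n : ℝ) * a β) * Real.sqrt (c * Γ ((n : ℝ) * a β)))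
        ≤ c₃ * (A * Real.sqrt A) := mul_le_mul_of_nonneg_left hmono hc₃.le
      _ = (n : ℝ) ^ 12 * (c₃ * covAxis r L β n * Real.sqrt (covAxis r L β n)) := by rw [hkey]; ring
      _ ≤ (n : ℝ) ^ 12 * kappa3 r L β n := mul_le_mul_of_nonneg_left hrig (by positivity)
      _ ≤ (n : ℝ) ^ 12 * |kappa3 r L β n| := mul_le_mul_of_nonneg_left (le_abs_self _) (by positivity)

end Glue

/-- **R1 (kernel): the ENGINE ALONE gives the ∃-bundled form of the crux** (verbatim `…Reduction.lean`). -/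
theorem skewnessForPackageMap_of : MarkedCouplingDominance → SkewnessForPackageMap := by
  intro hE G _ _ _ _ hG
  letI : MeasurableSpace G := borel G
  haveI : BorelSpace G := ⟨rfl⟩
  intro r hex
  obtain ⟨a₀, -, hP₀, hD₀⟩ := hE G hG r hex
  exact ⟨a₀, hP₀, skewnessPackage_of_signedRigidity r hP₀ (signedRigidity_of_dominance r a₀ hD₀)⟩

/-- **`FemtoCurvatureSkewness_of`** — the line's composition over exactly the THREE open stubs E, S, R (verbatim `…Reduction.lean`). -/
theorem FemtoCurvatureSkewness_of :
    MarkedCouplingDominance → GlobalSkewSign → InfraredFloor →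
      Summit.QuantumFields.YangMills.Theses.LangevinControlUV.FemtoCurvatureSkewness := by
  intro hE hS hR
  rw [femtoCurvatureSkewness_iff]
  intro G _ _ _ _ hG
  letI : MeasurableSpace G := borel G
  haveI : BorelSpace G := ⟨rfl⟩
  intro r a ha
  obtain ⟨a₀, hhon, hP₀, hD₀⟩ := hE G hG r ⟨a, ha⟩
  have hRig : SignedRigidity r a₀ := signedRigidity_of_dominance r a₀ hD₀
  exact skewnessPackage_of_floor r ha (hR G hG r a₀ hhon hP₀ hRig (hS G hG r))

end Skeleton

/-- Stub S IS the named statement (definitional bridge). -/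
theorem globalSkewSign_holds : GlobalSkewSign := Stub.GlobalSkewSign

/-- **The skeleton**: the crux modulo exactly the three registered open stubs, by the (landed) composition
`FemtoCurvatureSkewness_of` (E → S → R → crux; I and T are theorems of the tree). -/
theorem FemtoCurvatureSkewness_proof : FemtoCurvatureSkewness :=
  Skeleton.FemtoCurvatureSkewness_of Stub.MarkedCouplingDominance globalSkewSign_holds Stub.InfraredFloor

/-- **R1 side** (what the route's assembly actually consumes): the ∃-bundled form modulo the engine stub ALONE. -/
theorem skewnessForPackageMap_proof : SkewnessForPackageMap :=
  Skeleton.skewnessForPackageMap_of Stub.MarkedCouplingDominance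

end Summit.QuantumFields.YangMills.Cruxes.FemtoCurvatureSkewness.CouplingCubicResponse

end
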